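import Mathlib.RingTheory.Ideal.KrullsHeightTheorem
import Mathlib.RingTheory.Ideal.GoingDown
import Mathlib.RingTheory.RegularLocalRing.Defs
import Mathlib.RingTheory.RingHom.Flat
import Mathlib.RingTheory.Flat.Stability
import Mathlib.RingTheory.TensorProduct.Basic
import Mathlib.RingTheory.Localization.AtPrime.Basic
import Mathlib.RingTheory.LocalRing.ResidueField.Basic
import HarnessLib

/-!
# Regularity ascends along flat local homomorphisms with trivial closed fibre; the closed fibre
# of a completed base change

Topic: `Literature/AlgebraicGeometry/Resolution`. Local algebra for Grothendieck's theorem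
"resolution of singularities forces quasi-excellence" (EGA IV₂ (7.9.5), as rendered by Temkin
2008, §1; named fact `Grothendieck1965_7_9_5` of
`Literature/Barriers/ResolutionOfSingularities/QuasiExcellenceNecessary.lean`), step "the base
change `Y ×_A Â` of a regular `A`-scheme `Y` to the completion `Â` of the local ring `A` is
regular along the closed fibre" (EGA IV₂ (7.9.3)-type comparison). Everything is PROVED:

* `IsRegularLocalRing.of_flat_of_map_maximalIdeal_eq` — **Matsumura, Thm. 23.7 (ii), trivial
  fibre**: for a flat local homomorphism `A → B` of Noetherian local rings with `𝔪_A B = 𝔪_B`,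
  if `A` is regular then `B` is regular (`dim B = dim A` by the dimension formula, Matsumura
  Thm. 15.1, and `𝔪_B` needs at most `emb dim A = dim A` generators).
* `exists_mul_sub_tmul_one_mem_of_residue` — for a `D`-algebra `E`, local, whose residue field is
  generated by `D_P` (`∀ e, ∃ d, ∃ u ∉ P, u e - d ∈ 𝔪_E`): every element `w` of `B ⊗_D E`
  satisfies `(1 ⊗ u) w ≡ β ⊗ 1 (mod 𝔪_E (B ⊗_D E))` for some `β ∈ B`, `u ∉ P`.
* `comap_eq_map_of_closedFibre` — with moreover `𝔪_E = P E` and `𝔪_E ∩ D ⊆ P`: a prime `𝔷` of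
  `B ⊗_D E` containing `1 ⊗ 𝔪_E` is extended from `B`: `𝔷 = (𝔷 ∩ B)(B ⊗_D E)`.
* `isRegularLocalRing_localization_tensor_of_closedFibre` — with moreover `E` flat over `D` and
  `B ⊗_D E` Noetherian: if `B_{𝔷 ∩ B}` is regular then `(B ⊗_D E)_𝔷` is regular. (Applied with
  `E = (D_P)^`, the completion of a Noetherian local ring `D_P`, and `B` the coordinate ring of an
  affine open of a regular `D`-scheme: the completed base change is regular along the closed
  fibre.)

## Sources

* H. Matsumura, *Commutative Ring Theory*, CUP 1986, Thm. 23.7 (p. 182), Thm. 15.1 (p. 116).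
  [Matsumura1987]
* A. Grothendieck, EGA IV₂ (7.9.3), (7.9.5) (the application). [EGAIV2]
-/

noncomputable section

open IsLocalRing TensorProduct

namespace Literature.AlgebraicGeometry.Resolution

universe u v w

/-! ## Matsumura 23.7 (ii) with trivial closed fibre -/

/-- **Regularity ascends along a flat local homomorphism with `𝔪_A B = 𝔪_B`** (Matsumura,
Thm. 23.7 (ii), case of the trivial closed fibre `B/𝔪_A B = B/𝔪_B`): `dim B = dim A + dim B/𝔪_A B
= dim A` (Thm. 15.1, Mathlib `Ideal.height_eq_height_add_of_liesOver_of_hasGoingDown`), and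
`𝔪_B = 𝔪_A B` is generated by the images of `emb dim A = dim A` elements.
[cite: Matsumura1987, Thm. 23.7 and Thm. 15.1] -/
theorem IsRegularLocalRing.of_flat_of_map_maximalIdeal_eq (A B : Type*) [CommRing A] [CommRing B]
    [Algebra A B] [IsRegularLocalRing A] [IsLocalRing B] [IsLocalHom (algebraMap A B)]
    [IsNoetherianRing B] [Module.Flat A B]
    (h : (maximalIdeal A).map (algebraMap A B) = maximalIdeal B) : IsRegularLocalRing B := by
  have hdim : ringKrullDim B = ringKrullDim A := by
    have h' := Ideal.height_eq_height_add_of_liesOver_of_hasGoingDown (maximalIdeal A)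
      (maximalIdeal B)
    rw [h, Ideal.map_quotient_self, Ideal.height_bot, add_zero] at h'
    rw [← IsLocalRing.maximalIdeal_height_eq_ringKrullDim,
      ← IsLocalRing.maximalIdeal_height_eq_ringKrullDim, h']
  apply IsRegularLocalRing.of_spanFinrank_maximalIdeal_le
  rw [hdim, ← IsRegularLocalRing.spanFinrank_maximalIdeal, ← h]
  obtain ⟨s, hs, hspan⟩ := Submodule.FG.exists_span_finset_card_eq_spanFinrank
    (maximalIdeal A).fg_of_isNoetherianRing
  have : (maximalIdeal A).map (algebraMap A B) =
      Ideal.span ((algebraMap A B) '' (s : Set A)) := by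
    rw [← hspan]
    exact Ideal.map_span (algebraMap A B) (s : Set A)
  rw [this]
  refine WithBot.coe_le_coe.mpr (Nat.cast_le.mpr ?_)
  refine (Submodule.spanFinrank_span_le_ncard_of_finite ((Finset.finite_toSet s).image _)).trans
    ?_
  rw [← hs]
  exact (Set.ncard_image_le (Finset.finite_toSet s)).trans (by rw [Set.ncard_coe_finset])

/-! ## The closed fibre of `B ⊗_D E` for `E` local with residue field generated by `D_P` -/

section ClosedFibre

variable {D : Type u} [CommRing D] (P : Ideal D) [P.IsPrime] {E : Type v} [CommRing E]
  [Algebra D E] [IsLocalRing E] {B : Type w} [CommRing B] [Algebra D B]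

/-- If the residue field of the local `D`-algebra `E` is generated by `D_P` — every `e ∈ E` has
`u e ≡ d (mod 𝔪_E)` for some `d ∈ D`, `u ∈ D ∖ P` — then every `w ∈ B ⊗_D E` has
`(1 ⊗ u) w ≡ β ⊗ 1` modulo the ideal generated by `1 ⊗ 𝔪_E`, for some `β ∈ B`, `u ∉ P`.
[folklore] -/
theorem exists_mul_sub_tmul_one_mem_of_residue
    (hres : ∀ e : E, ∃ d : D, ∃ u ∉ P, algebraMap D E u * e - algebraMap D E d ∈ maximalIdeal E)
    (w : B ⊗[D] E) :
    ∃ β : B, ∃ u ∉ P, (1 : B) ⊗ₜ[D] algebraMap D E u * w - β ⊗ₜ[D] 1 ∈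
      (maximalIdeal E).map (Algebra.TensorProduct.includeRight (R := D) (A := B) (B := E)) := by
  set J : Ideal (B ⊗[D] E) :=
    (maximalIdeal E).map (Algebra.TensorProduct.includeRight (R := D) (A := B) (B := E)) with hJ
  have hJmem : ∀ m ∈ maximalIdeal E, ∀ b : B, b ⊗ₜ[D] m ∈ J := fun m hm b => by
    have : b ⊗ₜ[D] m = (b ⊗ₜ[D] (1 : E)) * ((1 : B) ⊗ₜ[D] m) := by
      rw [Algebra.TensorProduct.tmul_mul_tmul, mul_one, one_mul]
    rw [this]
    exact J.mul_mem_left _ (Ideal.mem_map_of_mem _ hm)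
  induction w using TensorProduct.induction_on with
  | zero =>
    exact ⟨0, 1, fun h1 => (Ideal.IsPrime.ne_top ‹_›) ((Ideal.eq_top_iff_one P).mpr h1),
      by simp⟩
  | tmul b e =>
    obtain ⟨d, u, hu, hmem⟩ := hres e
    refine ⟨d • b, u, hu, ?_⟩
    have : (1 : B) ⊗ₜ[D] algebraMap D E u * b ⊗ₜ[D] e - (d • b) ⊗ₜ[D] (1 : E) =
        b ⊗ₜ[D] (algebraMap D E u * e - algebraMap D E d) := by
      rw [Algebra.TensorProduct.tmul_mul_tmul, one_mul, TensorProduct.tmul_sub,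
        TensorProduct.smul_tmul, Algebra.smul_def, mul_one]
    rw [this]
    exact hJmem _ hmem b
  | add w₁ w₂ h₁ h₂ =>
    obtain ⟨β₁, u₁, hu₁, hm₁⟩ := h₁
    obtain ⟨β₂, u₂, hu₂, hm₂⟩ := h₂
    refine ⟨u₂ • β₁ + u₁ • β₂, u₁ * u₂, fun h => ?_, ?_⟩
    · rcases (Ideal.IsPrime.mem_or_mem ‹_› h) with h | h
      · exact hu₁ h
      · exact hu₂ h
    have key : (1 : B) ⊗ₜ[D] algebraMap D E (u₁ * u₂) * (w₁ + w₂) -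
        (u₂ • β₁ + u₁ • β₂) ⊗ₜ[D] (1 : E) =
        ((1 : B) ⊗ₜ[D] algebraMap D E u₂) * ((1 : B) ⊗ₜ[D] algebraMap D E u₁ * w₁ - β₁ ⊗ₜ[D] 1) +
        ((1 : B) ⊗ₜ[D] algebraMap D E u₁) *
          ((1 : B) ⊗ₜ[D] algebraMap D E u₂ * w₂ - β₂ ⊗ₜ[D] 1) := by
      have e₁ : (u₂ • β₁) ⊗ₜ[D] (1 : E) = ((1 : B) ⊗ₜ[D] algebraMap D E u₂) * (β₁ ⊗ₜ[D] 1) := by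
        rw [Algebra.TensorProduct.tmul_mul_tmul, one_mul, mul_one, TensorProduct.smul_tmul,
          Algebra.algebraMap_eq_smul_one]
      have e₂ : (u₁ • β₂) ⊗ₜ[D] (1 : E) = ((1 : B) ⊗ₜ[D] algebraMap D E u₁) * (β₂ ⊗ₜ[D] 1) := by
        rw [Algebra.TensorProduct.tmul_mul_tmul, one_mul, mul_one, TensorProduct.smul_tmul,
          Algebra.algebraMap_eq_smul_one]
      have e₃ : (1 : B) ⊗ₜ[D] algebraMap D E (u₁ * u₂) =
          ((1 : B) ⊗ₜ[D] algebraMap D E u₁) * ((1 : B) ⊗ₜ[D] algebraMap D E u₂) := by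
        rw [Algebra.TensorProduct.tmul_mul_tmul, one_mul, map_mul]
      rw [TensorProduct.add_tmul, e₁, e₂, e₃]
      ring
    rw [key]
    exact J.add_mem (J.mul_mem_left _ hm₁) (J.mul_mem_left _ hm₂)

/-- **Primes of `B ⊗_D E` over the closed point of `E` are extended from `B`.** Assume the
residue field of the local `D`-algebra `E` is generated by `D_P`, `𝔪_E = P E`, and
`𝔪_E ∩ D ⊆ P`. If a prime `𝔷` of `B ⊗_D E` contains `1 ⊗ 𝔪_E`, then `𝔷 = 𝔶 (B ⊗_D E)` for
`𝔶 = 𝔷 ∩ B`. [folklore] -/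
theorem comap_map_eq_of_closedFibre
    (hres : ∀ e : E, ∃ d : D, ∃ u ∉ P, algebraMap D E u * e - algebraMap D E d ∈ maximalIdeal E)
    (hmax : maximalIdeal E = P.map (algebraMap D E))
    (hcomap : (maximalIdeal E).comap (algebraMap D E) ≤ P)
    (𝔷 : Ideal (B ⊗[D] E)) [𝔷.IsPrime]
    (h𝔷 : maximalIdeal E ≤ 𝔷.comap
      (Algebra.TensorProduct.includeRight (R := D) (A := B) (B := E)).toRingHom) :
    (𝔷.comap (algebraMap B (B ⊗[D] E))).map (algebraMap B (B ⊗[D] E)) = 𝔷 := by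
  set T := B ⊗[D] E
  set incR := (Algebra.TensorProduct.includeRight (R := D) (A := B) (B := E)).toRingHom
    with hincR
  set 𝔶 := 𝔷.comap (algebraMap B T) with h𝔶
  refine le_antisymm (Ideal.map_le_iff_le_comap.mpr le_rfl) fun w hw => ?_
  -- `J = 𝔪_E T = P T ⊆ 𝔶 T` and `J ⊆ 𝔷`
  have hJ𝔷 : (maximalIdeal E).map incR ≤ 𝔷 := Ideal.map_le_iff_le_comap.mpr h𝔷
  have hPT : ∀ p ∈ P, algebraMap D T p ∈ 𝔷 := fun p hp => by
    have : algebraMap D T p = incR (algebraMap D E p) := by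
      rw [hincR]
      exact ((Algebra.TensorProduct.includeRight (R := D) (A := B) (B := E)).commutes p).symm
    rw [this]
    exact h𝔷 (hmax ▸ Ideal.mem_map_of_mem _ hp)
  have hJ𝔶 : (maximalIdeal E).map incR ≤ 𝔶.map (algebraMap B T) := by
    rw [hmax, Ideal.map_map]
    have hcomp : incR.comp (algebraMap D E) = (algebraMap B T).comp (algebraMap D B) := by
      ext p
      change incR (algebraMap D E p) = algebraMap B T (algebraMap D B p)
      rw [hincR]
      change (Algebra.TensorProduct.includeRight (R := D) (A := B) (B := E)) (algebraMap D E p) = _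
      rw [(Algebra.TensorProduct.includeRight (R := D) (A := B) (B := E)).commutes p,
        ← IsScalarTower.algebraMap_apply]
    rw [hcomp, ← Ideal.map_map]
    refine Ideal.map_mono (Ideal.map_le_iff_le_comap.mpr fun p hp => ?_)
    rw [Ideal.mem_comap, h𝔶, Ideal.mem_comap, ← IsScalarTower.algebraMap_apply]
    exact hPT p hp
  obtain ⟨β, u, hu, hmem⟩ := exists_mul_sub_tmul_one_mem_of_residue P hres w
  -- `β ⊗ 1 ∈ 𝔷`, hence `β ∈ 𝔶`
  have hβ : β ⊗ₜ[D] (1 : E) ∈ 𝔷 := by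
    have h1 : (1 : B) ⊗ₜ[D] algebraMap D E u * w ∈ 𝔷 := 𝔷.mul_mem_left _ hw
    have h2 := 𝔷.sub_mem h1 (hJ𝔷 hmem)
    rwa [sub_sub_cancel] at h2
  have hβ' : β ⊗ₜ[D] (1 : E) ∈ 𝔶.map (algebraMap B T) := by
    apply Ideal.mem_map_of_mem
    rw [h𝔶, Ideal.mem_comap]
    exact hβ
  -- so `(1 ⊗ u) w ∈ 𝔶 T`, and `1 ⊗ u` is a unit
  have huw : (1 : B) ⊗ₜ[D] algebraMap D E u * w ∈ 𝔶.map (algebraMap B T) := by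
    have := (𝔶.map (algebraMap B T)).add_mem (hJ𝔶 hmem) hβ'
    rwa [sub_add_cancel] at this
  have hunit : IsUnit ((1 : B) ⊗ₜ[D] algebraMap D E u) := by
    have hu' : IsUnit (algebraMap D E u) := by
      by_contra hnu
      exact hu (hcomap ((mem_maximalIdeal _).mpr hnu))
    have : (1 : B) ⊗ₜ[D] algebraMap D E u = incR (algebraMap D E u) := rfl
    rw [this]
    exact hu'.map incR
  obtain ⟨v, hv⟩ := hunit.exists_left_inv
  have : w = v * ((1 : B) ⊗ₜ[D] algebraMap D E u * w) := by rw [← mul_assoc, hv, one_mul]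
  rw [this]
  exact Ideal.mul_mem_left _ _ huw

/-- **The completed base change is regular along the closed fibre.** Let `E` be a local
`D`-algebra, flat over `D`, with residue field generated by `D_P`, `𝔪_E = P E` and
`𝔪_E ∩ D ⊆ P` (e.g. `E = (D_P)^` for `D` Noetherian), and let `B` be a `D`-algebra with
`B ⊗_D E` Noetherian. For a prime `𝔷` of `B ⊗_D E` containing `1 ⊗ 𝔪_E` with `𝔶 = 𝔷 ∩ B`:
if `B_𝔶` is a regular local ring then so is `(B ⊗_D E)_𝔷` — the local homomorphism
`B_𝔶 → (B ⊗_D E)_𝔷` is flat with `𝔶 (B ⊗_D E)_𝔷` the maximal ideal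
(`comap_map_eq_of_closedFibre`), and Matsumura Thm. 23.7 (ii) applies
(`IsRegularLocalRing.of_flat_of_map_maximalIdeal_eq`). (EGA IV₂ (7.9.3)-type statement used in
the proof of (7.9.5).) [cite: Matsumura1987, Thm. 23.7] -/
theorem isRegularLocalRing_localization_tensor_of_closedFibre [Module.Flat D E]
    [IsNoetherianRing (B ⊗[D] E)]
    (hres : ∀ e : E, ∃ d : D, ∃ u ∉ P, algebraMap D E u * e - algebraMap D E d ∈ maximalIdeal E)
    (hmax : maximalIdeal E = P.map (algebraMap D E))
    (hcomap : (maximalIdeal E).comap (algebraMap D E) ≤ P)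
    (𝔷 : Ideal (B ⊗[D] E)) [𝔷.IsPrime]
    (h𝔷 : maximalIdeal E ≤ 𝔷.comap
      (Algebra.TensorProduct.includeRight (R := D) (A := B) (B := E)).toRingHom)
    (hreg : IsRegularLocalRing
      (Localization.AtPrime (𝔷.comap (algebraMap B (B ⊗[D] E))))) :
    IsRegularLocalRing (Localization.AtPrime 𝔷) := by
  set T := B ⊗[D] E
  set 𝔶 := 𝔷.comap (algebraMap B T) with h𝔶
  set f := Localization.localRingHom 𝔶 𝔷 (algebraMap B T) h𝔶 with hfdef
  have hflatBT : (algebraMap B T).Flat := RingHom.flat_algebraMap_iff.mpr inferInstance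
  have hf : f.Flat := hflatBT.localRingHom 𝔷 𝔶 h𝔶
  letI : Algebra (Localization.AtPrime 𝔶) (Localization.AtPrime 𝔷) := f.toAlgebra
  haveI : Module.Flat (Localization.AtPrime 𝔶) (Localization.AtPrime 𝔷) := hf
  haveI : IsLocalHom (algebraMap (Localization.AtPrime 𝔶) (Localization.AtPrime 𝔷)) :=
    Localization.isLocalHom_localRingHom 𝔶 𝔷 (algebraMap B T) h𝔶
  refine IsRegularLocalRing.of_flat_of_map_maximalIdeal_eq (Localization.AtPrime 𝔶)
    (Localization.AtPrime 𝔷) ?_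
  change (maximalIdeal (Localization.AtPrime 𝔶)).map f = maximalIdeal (Localization.AtPrime 𝔷)
  rw [← Localization.AtPrime.map_eq_maximalIdeal, ← Localization.AtPrime.map_eq_maximalIdeal,
    Ideal.map_map]
  have hcomp : f.comp (algebraMap B (Localization.AtPrime 𝔶)) =
      (algebraMap T (Localization.AtPrime 𝔷)).comp (algebraMap B T) := by
    ext b
    exact Localization.localRingHom_to_map 𝔶 𝔷 (algebraMap B T) h𝔶 b
  rw [hcomp, ← Ideal.map_map, comap_map_eq_of_closedFibre P hres hmax hcomap 𝔷 h𝔷]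

end ClosedFibre

end Literature.AlgebraicGeometry.Resolution

end
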